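import Literature.MathematicalPhysics.QuantumFieldTheory.Balaban1983to89.B4Ineq115Torus
import Literature.MathematicalPhysics.QuantumFieldTheory.Balaban1983to89.B4TorusGreen244

/-!
# (1.16) of Bałaban [4] ON THE TORUS: exponential decay of the rescaled fluctuation covariance `C^{(j)}` of the
# concrete scalar torus tower, uniformly in the volume and the level — through the identification of the tower's
# `G_jQ_j^*` with the finite-torus kernel of (2.48)

B4 = [4] = T. Bałaban, *Regularity and decay of lattice Green's functions*, Commun. Math. Phys. **89** (1983)
571–597 [cite: Balaban1983RegularityDecay]; B1 = [1] = *(Higgs)₂,₃ quantum fields in a finite volume I*, Commun.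
Math. Phys. **85** (1982) 603–636 [cite: Balaban1982Higgs1]; B5 = *Propagators and renormalization transformations
for lattice gauge theories I*, Commun. Math. Phys. **95** (1984) 17–40 [cite: Balaban1984PropagatorsI].
Cell records: GAPS G-pv07-5 residue (R3) (the located leaf `B5Ineq137.Leaf235to237` of `B5Ineq137Torus`; conjunct
`K2` = the entries of `B5Display136Torus.Crs`, `K2_eq`), this module = node G-pv07-5f (b2b-balaban-pv07-g7),
certification C-pv07-27, DIVERGENCE D-pv07.20; v1.2 = DOCFIX only (XREAD C-pv15g5-1 D1: «Lemma 5.2» → the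
Theorem of Sect. 5 in the `abs_Crs_le` docstring; GAPS C-pv07-30).  value = kernel certificate for a by-reference step, NOT summit
progress.  Renders `1983-cmp89-regularity-decay-p004/p012/p023/p024-x2.png` read as images by this seat; the
p. 572 / p. 584–586 and B5 p. 25 / p. 36 sentences are quoted from the headers of `B4TorusGreen244` /
`B4Torus248Decay` (b04 lineage, renders read there).

## The printed step

* B4 p. 574 [PDF 4]: *"Proposition 2.3 of [1]. There exist positive constants δ₀, c₀, γ₀, γ₁ dependent on d and
  M only and such that for arbitrary Λ ⊂ Ω^{(k)} = Ω∩Z^d, Λ being a sum of big blocks and for e sufficiently small,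
  we have γ₀I ≤ Δ^{(k)}(Ω, A) + aL^{−2}P(A) ≤ γ₁I, (1.15) |C^{(k)}_Λ(Ω, A; x, x′)| ≤ c₀ exp(−δ₀|x − x′|), x, x′ ∈ Λ.
  (1.16)"*; same page: *"The fifth section will be devoted to a general theorem concerning operators on the unit
  lattice Z^d. There we have abstracted some basic features of our method and we have proven a theorem which, if
  applied to operators (1.14), gives another proof of Proposition 2.3."*
* B4 p. 593 [PDF 23]: *"5. A General Theorem on Unit Lattice Operators. There is another way of proving Proposition
  I.2.3, relying on a general theorem concerning inverses to some unit lattice operators. … The upper bound is quite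
  elementary because Δ^{(k)}(Ω, A) + aL^{−2}P(A) = a_kI − a_k²Q_k(A)G_k(Ω, A)Q_k^*(A) + aL^{−2}P(A) ≤ a_kI +
  aL^{−2}Q^*(A)Q(A) ≤ (a_k + aL^{−2})I = a(a_k/a_{k+1})I. (5.1) … Finally Corollary 2.3 implies that the considered
  operator is short-ranged in the sense that for some δ₀ > 0 |(Δ^{(k)}(Ω, A) + aL^{−2}P(A))(x, x′)| ≤
  c₀e^{−δ₀|x−x′|}, x, x′ ∈ Ω^{(k)}, (5.4)"*; p. 594 [PDF 24]: *"From these properties it follows that Proposition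
  I.2.3 is a consequence of the following Theorem. Let Ω ⊂ Z^d and let A be a symmetric operator … there exist
  positive constants γ₀, c₀, δ₀ such that A ≥ γ₀I, |A(x, x′)| ≤ c₀e^{−δ₀|x−x′|}, x, x′ ∈ Ω. (5.6) Then there exist
  positive constants c₁, δ₁ such that for arbitrary Λ ⊂ Ω and for C_Λ = A_Λ^{−1} … |C_Λ(x, x′)| ≤ c₁e^{−δ₁|x−x′|},
  x, x′ ∈ Λ, (5.7)"* — kernel-proved on the torus as `B4Sect5Torus.inv_decay` (r1/pv17/b04 lineages).
* B4 p. 582 [PDF 12]: *"Lemma 2.4. There exist positive constants c₀, δ₀, and for α < 1, there exists a constant c₁,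
  such that |(G_j(□)Q_j^*)(x, y)|, |(∂^{L^{−j}}_μ G_j(□)Q_j^*)(x, y)| ≤ c₀e^{−δ₀|x−y|}, (2.35) … |C^{(j)}(□; y, y′)| ≤
  c₀e^{−δ₀|y−y′|}, (2.37) for arbitrary non-negative integer j, arbitrary, rectangular parallelepiped □ ⊂ L^{−j}Z^d
  built of large blocks, and x, x′ ∈ □, y, y′ ∈ □^{(j)} = □∩Z^d."* — the first quantity of (2.35) comes from the
  momentum formula (2.48) p. 585 (*"We apply it to the basic equation (−Δ^ξ + m_j² + a_jQ_j^*Q_j)φ₀ = f. (2.44)"*,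
  p. 584), kernel-proved ON THE TORUS by the b04 lineage: `B4Torus248Decay.kernel248_torusKernel_decay_torusMetric`
  (volume-, level-, mass- and offset-uniform decay of the finite-torus kernel `torusKernel248`) and
  `B4TorusGreen244.torusGreen244` (that kernel solves (2.44) on the torus with `f = Q_j^*δ_y`: the EXISTENCE half;
  its HONEST SCOPE (ii) left uniqueness — that the kernel IS the operator's Green function — untyped).
* The torus: B4 p. 572 *"Another common case is to consider operators on subsets of a torus T_η which we identify
  with a rectangular parallelepiped in ηZ^d with periodic conditions."*; B5 p. 25 l. 35–36 *"It is a translation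
  invariant operator on the unit lattice T₁^{(k)} and its Fourier transform can be written using formula (2.48)"*,
  p. 36 l. 20–23 *"Probably the simplest proof of the exponential decay properties can be obtained by relating G on
  the torus to G on the whole lattice ηZ^d in the usual way"*.

## What this file proves (U = 1, Ω = Λ = □ = the whole torus, m² ≥ 0 with a mass cap, a > 0, levels j ≥ 1)

Objects: Bałaban's concrete scalar torus tower `B1RG242Torus.tower P a msq` (`P : Params` = (d, L, m, K); the
level-j torus `Site P j = (ℤ/N_j)^d`, `N_j = 2L^{m+K−j}`), its rescaled objects of `B5Display136Torus` — `Grs P a msq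
j` = G_j of (2.22) (argument `B4Ineq115Torus.Marg`), `Drs` = Δ^{(j)} of (2.21), `Crs = (aL^{−2}Q^*Q + Drs)^{−1}` =
(2.31) (argument `B4Ineq115Torus.Carg`) — and the sup torus metric `B5Ineq137Torus.T P j` (= the printed |y − y′|
in L^jε-units).
* §1 THE DICTIONARY `Site P i ↔ ℤ^d`: `rep x ∈ [0, N_i)^d` (injective), `ofInt`, periodic functions `Periodic N φ`,
  `rep (shift x μ) ≡ rep x + e_μ`, `rep (proj x) = ⌊rep x / L^a⌋` (`rep_proj` — blocks never straddle the
  identification since `N_0 = L^j N_j`), `rep (fibreSite y r) = L^a·rep y + r`, block sums = sums over `Fin d → Fin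
  (L^a)` (`sum_fibre`).
* §2 THE LIFT LEMMA `Marg_lift`: for an `N_0`-periodic `φ : ℤ^d → ℂ`, the tower's operator `Marg P a msq j =
  −Δ^{L^{−j}} + (L^jε)²m² + a_jQ_j^*Q_j` (in L^jε-units, `hOp_spacing_eq`: `−Δ^{L^{−j}} = L^{2j}(−Δ¹)`) applied to
  `φ ∘ rep` IS `B4Green244.opD (L^j) a_j ((L^jε)²m²) φ` read at `rep x` — the fine-torus operator of p. 572 (1.6) with
  A = 0 in ξ-units (`ξ = L^{−j}`, n = L^j) — entry by entry (`actC_dd`, `actC_EA`, `wj_eq_inv`).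
* §3 UNIQUENESS AND IDENTIFICATION (closes `B4TorusGreen244` HONEST SCOPE (ii) and `B4Torus248Decay` NOT-covered (ii)
  for the tower): `Marg` is invertible (`B4Ineq115Torus.Marg_isUnit`, from block Poincaré), hence injective on
  complex vectors (`actC_Marg_injective`); the column `x ↦ (G_jQ_j^*)(x, y)` and the periodic torus-kernel column
  `colKT y = KT (L^j) a_j ((L^jε)²m²) (N_j)_μ · (rep y)` (`colKT_periodic` ⇐ `KT_translate_left`) are both mapped by
  `Marg` to `1[proj x = y]` (`Marg_mulVec_GQcol`; `actC_Marg_colKT` ⇐ `Marg_lift` + `torusGreen244` +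
  `proj_eq_iff_dvd`), so **`GQ_eq_KT`: `(G_j^{resc}Q_j^*)(x, y) = KT(rep x, rep y)`** — the tower's Green column IS the
  (2.48) finite-torus kernel (stated for `P = mkP d′ L m K`, i.e. in dimension `d′ + 1 ≥ 1`, the indexing of the
  b04 torus engine `B4TorusKernel.MultiPeriod`).
* §4 (2.35) ON THE TORUS, FIRST QUANTITY (`GQ_bound_of`, uniform: `GQ_decay_torus`): `|(G_jQ_j^*)(x, y)| ≤
  M·C(κ,d′)·e^{−κ/(d′+1)·T^{(j)}(proj x, y)}` and, summing the block with the weight `L^{−jd}` (`card_Bj`),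
  `|(Q_jG_jQ_j^*)(y′, y)| ≤ M·C(κ,d′)·e^{−κ/(d′+1)·T^{(j)}(y′, y)}`, where `(κ, M)` are b04's constants for the window
  `a_j ∈ [a(1 − L^{−2}), a]` (`B1.ainf_lt_aSeq`, `B1.aSeq_le`), `m_j² = (L^jε)²m² ∈ [0, m²₊]` (`DecayHyp`,
  `decayHyp_exists` = `kernel248_torusKernel_decay_torusMetric`), and `T^{(j)} ≤` b04's `torusSupNorm` of the
  difference of representatives (`T_le_torusSupNorm`).
* §5 (5.4) AND (5.6) ON THE TORUS (`abs_Carg_le`, `Carg_hyp56`): with `Δ^{(j)} = a_j − a_j²Q_jG_jQ_j^*` ((2.21),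
  `Drs` by definition), `|Q^*Q(y′, y)| ≤ e^{κ′(L−1)}e^{−κ′T}` (range ≤ L − 1: `abs_QsQ_le` ⇐
  `B5Leaf237C0Torus.T_le_of_EA_ne_zero`) and `|δ_{y′y}| ≤ e^{−κ′T}`:
  `|(aL^{−2}Q^*Q + Δ^{(j)})(y′, y)| ≤ c₀e^{−κ′T^{(j)}(y′,y)}`, `κ′ = κ/(d′+1)`, `c₀ = c116 = aL^{−2}e^{κ′(L−1)} + a +
  a²MC(κ,d′)`; together with `B4Ineq115Torus.Carg_isSymm` / `Carg_coercive_sum` ((1.15), γ₀ = `gamma115u L a`) this is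
  `B4Sect5Torus.Hyp56 (T P j) (Carg P a msq j) γ₀ c₀ κ′`.
* §5–§6 **(1.16) = (2.37) = (5.7) ON THE TORUS** (`abs_Crs_le` at one volume; **`cov116_torus`** uniformly): for every
  `d ≥ 1`, odd `L > 1`, `a > 0`, `m²₊` there are `δ₀ > 0`, `c₀ ≥ 0` — FUNCTIONS OF `d, L, a, m²₊` ONLY (`δ₀ =
  B4Sect5Torus.rate K_d γ₀ c₀ κ′`, `c₀ = 2/γ₀`) — with `|C^{(j)}(y, y′)| ≤ c₀e^{−δ₀T^{(j)}(y,y′)}` for EVERY volume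
  (m, K), every `m² ≥ 0`, every level `1 ≤ j ≤ m + K` with `(L^jε)²m² ≤ m²₊`, all `y, y′` — by `B4Sect5Torus.inv_decay`.
* §7 `K2_decay_torus`: the same as the `K2` line of `B5Leaf237C0Torus.LeafK123` for the concrete `scaleData` (fields
  `K2 P a msq`, `dUU P` by `rfl`; `K2_eq`, `dUU_level`; zero off the level), under the cap at the top level `k`.

## Dictionary / HONEST SCOPE

(i) ξ-units throughout §2–§4 (`n = L^j`, fine point `rep x ∈ ℤ^{d}`, block label `⌊rep x/L^j⌋ = rep (proj x)`); the
(length)^{−2} factors of (2.21)/(2.34) are already divided out in `B5Display136Torus` (`Grs`, `Drs`, `Crs`,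
`C_eq_smul_Crs`).  (ii) Dimension: the identification and the decay are stated for `P = mkP d′ L m K = ⟨d′+1, L, m,
K⟩` because the torus engine is indexed by `Fin (d′+1)`; the final theorems `cov116_torus`, `GQ_decay_torus`,
`K2_decay_torus` quantify over ALL `P : Params` with `P.d = d ≥ 1`, `P.L = L` (by `cases P`).  (iii) The mass cap
`(L^jε)²m² ≤ m²₊` is the hypothesis under which b04's constants are uniform (`m² ∈ [0, m²₊]`); Bałaban's flows stop
before `m²(L^kε)²` is large, and `K2_decay_torus` takes the cap at the top level `k` (`spacing_le_spacing`).  (iv) The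
distance is the sup torus metric `T^{(j)}` of `B5Ineq137Torus` (B4's `|x − x′|` is not specified between ℓ¹/ℓ²/ℓ^∞;
all constants are dimension-dependent anyway).

## NOT-CERTIFIED

(a) Regions Ω, Λ, □ other than the whole torus, Neumann/Dirichlet boundary conditions, big blocks M, (5.8)–(5.10):
none (whole torus only; B4 itself needs parallelepipeds with Neumann conditions via the reflections (2.42) — pv17
`B4Reflection242` — the torus case is the one consumed by B5/B6 and by the located leaf).  (b) U ≠ 1 / background
field A.  (c) The second quantity of (2.35) (the derivative `∂^{L^{−j}}G_jQ_j^*`, conjuncts K1/K3 of the leaf) and the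
Hölder bound (2.36): NOT here (they need b04's `torusKernelD248` / `dkernel248_torusKernel_decay_torusMetric` through
the same identification — next node).  (d) The printed route to (5.4) is *"Corollary 2.3"* (random-walk expansion);
this file obtains (5.4) on the torus from (2.35)'s first quantity instead (D-pv07.20).  (e) Constants are explicit
functions of b04's `(κ, M)`, which are existential (contour shift) — no numerical values.  (f) j = 0 is
`B5Leaf237C0Torus` (a₀ is not Bałaban's).

## DISTINCTNESS (other formalizations in the tree)

`B4BoxCov237` v2 (pv17-g6, p182008) proves (1.16)/(2.37) for SUB-BOXES Λ of a box with the box Green machinery;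
`Beta/FluctuationCovariance` (pv23-g4) proves (1.15)/(1.16) for the massless toy operator `Cop` on
`Beta.EffectiveKernel.Tor`.  The present file treats the B1RG242Torus tower's `Crs` on `Site P j` (the object read by
`B5Display136Torus.K2_eq` and by the leaf `B5Ineq137.Leaf235to237`), imports neither, and its new ingredient is the
identification §3 of the tower's Green column with b04's finite-torus (2.48) kernel.

Versions: v1 (p182129, 7495dc1f65fa); v1.1 (this file) — DOCFIX, docstrings only: in the B4 p. 574 quote above (1.15)
reads «aL^{−2}P(A)» (A = the background gauge field, Λ = the region; v1 had «P(Λ)» — the slip flagged by XREAD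
C-ref6-87 advisory A1 on the sibling `B4Ineq115Torus`; render p004-x2 re-read as image). No declaration changed.
-/

namespace Literature.MathematicalPhysics.QuantumFieldTheory.Balaban1983to89

namespace B4Ineq116Torus

open Matrix B1RG242Torus B5Display136Torus B5Leaf237C0Torus B4Ineq115Torus B5Ineq137Torus
open B4Green244 (coarse offset finePt e negLap blockAvg opD)

noncomputable section

/-! ## §1 The dictionary: the fine torus `T^{(0)} = (ℤ/N₀)^d` as `N₀`-periodic points of `ℤ^d` -/

section Dictionary

variable (P : Params) {i : ℕ}

/-- The integer representative of a torus site: `rep x = (val x_μ)_μ ∈ [0, N)^d ⊂ ℤ^d`. [folklore] -/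
def rep (x : Site P i) : Fin P.d → ℤ := fun μ => ((x μ).val : ℤ)

/-- The class of an integer point on the torus `T^{(i)}`. [folklore] -/
def ofInt (i : ℕ) (z : Fin P.d → ℤ) : Site P i := fun μ => ((z μ : ℤ) : ZMod (P.sitesPerDir i))

variable {P}

/-- `rep` is injective. [folklore] -/
theorem rep_injective : Function.Injective (rep P (i := i)) := by
  intro x x' h
  funext μ
  apply ZMod.val_injective
  have hμ := congrFun h μ
  simp only [rep] at hμ
  exact_mod_cast hμ

/-- `0 ≤ rep x μ`. [folklore] -/
theorem rep_nonneg (x : Site P i) (μ : Fin P.d) : 0 ≤ rep P x μ := Int.natCast_nonneg _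

/-- `rep x μ < N`. [folklore] -/
theorem rep_lt (x : Site P i) (μ : Fin P.d) : rep P x μ < P.sitesPerDir i := by
  unfold rep; exact_mod_cast ZMod.val_lt (x μ)

/-- `ofInt (rep x) = x`. [folklore] -/
theorem ofInt_rep (x : Site P i) : ofInt P i (rep P x) = x := by
  funext μ
  simp only [ofInt, rep, Int.cast_natCast, ZMod.natCast_zmod_val]

/-- `rep (ofInt z) ≡ z (mod N)`: `rep (ofInt z) = z + N·k` with `k_μ = −⌊z_μ/N⌋`. [folklore] -/
theorem rep_ofInt (z : Fin P.d → ℤ) :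
    rep P (ofInt P i z) = fun μ => z μ + (P.sitesPerDir i : ℤ) * (-(z μ / P.sitesPerDir i)) := by
  funext μ
  simp only [rep, ofInt, ZMod.val_intCast]
  rw [Int.emod_def]; ring

/-- A function on `ℤ^d` is `N`-PERIODIC (coordinatewise). [folklore] -/
def Periodic (N : ℕ) (φ : (Fin P.d → ℤ) → ℂ) : Prop :=
  ∀ z k : Fin P.d → ℤ, φ (fun μ => z μ + (N : ℤ) * k μ) = φ z

/-- For an `N`-periodic `φ`: `φ (rep (ofInt z)) = φ z`. [folklore] -/
theorem Periodic.rep_ofInt {φ : (Fin P.d → ℤ) → ℂ} (hφ : Periodic (P := P) (P.sitesPerDir i) φ)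
    (z : Fin P.d → ℤ) : φ (rep P (ofInt P i z)) = φ z := by
  rw [B4Ineq116Torus.rep_ofInt]; exact hφ z _

/-- The unit shift of the torus is `+e_μ` on representatives: `x + e_μ = ofInt (rep x + e_μ)`. [folklore] -/
theorem shift_eq_ofInt (x : Site P i) (μ : Fin P.d) : Site.shift x μ = ofInt P i (rep P x + e μ) := by
  funext ν
  simp only [Site.shift, ofInt, rep, e, Pi.add_apply, Pi.single_apply, Function.update_apply]
  split_ifs with h
  · subst h; push_cast; rw [ZMod.natCast_zmod_val]
  · push_cast; rw [ZMod.natCast_zmod_val, add_zero]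

/-- `x − e_μ = ofInt (rep x − e_μ)`. [folklore] -/
theorem unshift_eq_ofInt (x : Site P i) (μ : Fin P.d) : Site.unshift x μ = ofInt P i (rep P x - e μ) := by
  funext ν
  simp only [Site.unshift, ofInt, rep, e, Pi.sub_apply, Pi.single_apply, Function.update_apply]
  split_ifs with h
  · subst h; push_cast; rw [ZMod.natCast_zmod_val]
  · push_cast; rw [ZMod.natCast_zmod_val, sub_zero]

/-- Periodic `φ` at a shifted site: `φ(rep (x + e_μ)) = φ(rep x + e_μ)`. [folklore] -/
theorem Periodic.shift {φ : (Fin P.d → ℤ) → ℂ} (hφ : Periodic (P := P) (P.sitesPerDir i) φ) (x : Site P i)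
    (μ : Fin P.d) : φ (rep P (Site.shift x μ)) = φ (rep P x + e μ) := by
  rw [shift_eq_ofInt, hφ.rep_ofInt]

/-- Periodic `φ` at a back-shifted site: `φ(rep (x − e_μ)) = φ(rep x − e_μ)`. [folklore] -/
theorem Periodic.unshift {φ : (Fin P.d → ℤ) → ℂ} (hφ : Periodic (P := P) (P.sitesPerDir i) φ) (x : Site P i)
    (μ : Fin P.d) : φ (rep P (Site.unshift x μ)) = φ (rep P x - e μ) := by
  rw [unshift_eq_ofInt, hφ.rep_ofInt]

/-- BLOCKS ARE `coarse`: `rep (proj x) = ⌊rep x / L^a⌋` coordinatewise. [folklore] -/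
theorem rep_proj {i' a : ℕ} (h : P.sitesPerDir i = P.L ^ a * P.sitesPerDir i') (x : Site P i) :
    rep P (Site.proj i' a x) = coarse (P.L ^ a) (rep P x) := by
  funext μ
  simp only [rep, coarse, Site.val_proj h]
  push_cast
  rfl

/-- FIBRE POINTS ARE `finePt`: `rep (fibreSite y r) = L^a · rep y + r`. [folklore] -/
theorem rep_fibreSite {i' a : ℕ} (h : P.sitesPerDir i = P.L ^ a * P.sitesPerDir i') (y : Site P i')
    (r : Fin P.d → Fin (P.L ^ a)) : rep P (Site.fibreSite i a y r) = finePt (P.L ^ a) (rep P y) r := by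
  funext μ
  simp only [rep, finePt, Site.val_fibreSite h]
  push_cast
  ring

/-- Sums over a block through the fibre chart (any additive target). [folklore] -/
theorem sum_fibre {M : Type*} [AddCommMonoid M] {i' a : ℕ} (h : P.sitesPerDir i = P.L ^ a * P.sitesPerDir i')
    (y : Site P i') (g : Site P i → M) :
    ∑ x ∈ Finset.univ.filter (fun x : Site P i => Site.proj i' a x = y), g x
      = ∑ r : Fin P.d → Fin (P.L ^ a), g (Site.fibreSite i a y r) := by
  rw [Finset.sum_subtype (Finset.univ.filter fun x : Site P i => Site.proj i' a x = y)
      (p := fun x : Site P i => Site.proj i' a x = y) (fun x => by simp),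
    ← (Site.fibreEquiv h y).symm.sum_comp]
  rfl

end Dictionary

/-! ## §2 The lift lemma: `−Δ^{L^{−j}} + m²(L^jε)² + a_jQ_j^*Q_j` acts on periodic lifts as `B4Green244.opD` -/

section Lift

variable {ι : Type*} [Fintype ι] [DecidableEq ι]

/-- The action of a REAL matrix on a COMPLEX vector: `(Aψ)(x) = Σ_{x′} A(x,x′)ψ(x′)` (`= (A.map ofReal) *ᵥ ψ`,
`actC_eq_mulVec`). [folklore] -/
def actC (A : Matrix ι ι ℝ) (ψ : ι → ℂ) (x : ι) : ℂ := ∑ x', (A x x' : ℂ) * ψ x'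

omit [DecidableEq ι] in
/-- `actC A ψ = (A.map ofReal) *ᵥ ψ`. [folklore] -/
theorem actC_eq_mulVec (A : Matrix ι ι ℝ) (ψ : ι → ℂ) (x : ι) :
    actC A ψ x = ((A.map Complex.ofRealHom) *ᵥ ψ) x := rfl

omit [DecidableEq ι] in
/-- On real vectors `actC` is the real action: `actC A (ofReal ∘ v) x = ((A *ᵥ v) x : ℂ)`. [folklore] -/
theorem actC_ofReal (A : Matrix ι ι ℝ) (v : ι → ℝ) (x : ι) :
    actC A (fun x' => ((v x' : ℝ) : ℂ)) x = (((A *ᵥ v) x : ℝ) : ℂ) := by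
  simp only [actC, Matrix.mulVec, dotProduct, Complex.ofReal_sum, Complex.ofReal_mul]

omit [DecidableEq ι] in
/-- Additivity in the matrix. [folklore] -/
theorem actC_add (A B : Matrix ι ι ℝ) (ψ : ι → ℂ) (x : ι) : actC (A + B) ψ x = actC A ψ x + actC B ψ x := by
  simp only [actC, Matrix.add_apply, Complex.ofReal_add, add_mul, Finset.sum_add_distrib]

omit [DecidableEq ι] in
/-- Subtractivity in the matrix. [folklore] -/
theorem actC_sub (A B : Matrix ι ι ℝ) (ψ : ι → ℂ) (x : ι) : actC (A - B) ψ x = actC A ψ x - actC B ψ x := by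
  simp only [actC, Matrix.sub_apply, Complex.ofReal_sub, sub_mul, Finset.sum_sub_distrib]

omit [DecidableEq ι] in
/-- Homogeneity in the matrix. [folklore] -/
theorem actC_smul (c : ℝ) (A : Matrix ι ι ℝ) (ψ : ι → ℂ) (x : ι) : actC (c • A) ψ x = (c : ℂ) * actC A ψ x := by
  simp only [actC, Matrix.smul_apply, smul_eq_mul, Complex.ofReal_mul, mul_assoc, Finset.mul_sum]

omit [DecidableEq ι] in
/-- Finite sums of matrices. [folklore] -/
theorem actC_sum {κ : Type*} (s : Finset κ) (A : κ → Matrix ι ι ℝ) (ψ : ι → ℂ) (x : ι) :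
    actC (∑ k ∈ s, A k) ψ x = ∑ k ∈ s, actC (A k) ψ x := by
  simp only [actC, Matrix.sum_apply, Complex.ofReal_sum, Finset.sum_mul]
  rw [Finset.sum_comm]

/-- The identity matrix acts as the identity. [folklore] -/
theorem actC_one (ψ : ι → ℂ) (x : ι) : actC (1 : Matrix ι ι ℝ) ψ x = ψ x := by
  have h : ∀ x', (((1 : Matrix ι ι ℝ) x x' : ℝ) : ℂ) * ψ x' = if x = x' then ψ x' else 0 := by
    intro x'
    rw [Matrix.one_apply]
    split_ifs <;> simp
  simp only [actC, h, Finset.sum_ite_eq, Finset.mem_univ, if_true]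

omit [DecidableEq ι] in
/-- `actC (Aᵀ B) ψ x = Σ_z A(z,x) · actC B ψ z`. [folklore] -/
theorem actC_transpose_mul (A B : Matrix ι ι ℝ) (ψ : ι → ℂ) (x : ι) :
    actC (Aᵀ * B) ψ x = ∑ z, (A z x : ℂ) * actC B ψ z := by
  simp only [actC, Matrix.mul_apply, Matrix.transpose_apply, Complex.ofReal_sum, Complex.ofReal_mul,
    Finset.sum_mul, Finset.mul_sum, mul_assoc]
  rw [Finset.sum_comm]

variable {P : Params} {i : ℕ}

/-- The cast of an indicator. [folklore] -/
theorem ofReal_ite (p : Prop) [Decidable p] : (((if p then (1 : ℝ) else 0) : ℝ) : ℂ) = if p then 1 else 0 := by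
  split_ifs <;> simp

/-- The unit forward difference on complex vectors: `(∂¹_μψ)(z) = ψ(z + e_μ) − ψ(z)`. [cite: Balaban1982Higgs1, (1.11) p.605] -/
theorem actC_deriv (μ : Fin P.d) (ψ : Site P i → ℂ) (z : Site P i) :
    actC (B1RG242Torus.deriv P i 1 μ) ψ z = ψ (Site.shift z μ) - ψ z := by
  simp only [actC, deriv_one_apply, Complex.ofReal_sub, ofReal_ite, sub_mul, ite_mul, one_mul, zero_mul,
    Finset.sum_sub_distrib, Finset.sum_ite_eq, Finset.sum_ite_eq', Finset.mem_univ, if_true]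

/-- **The unit Laplacian stencil on the torus**: `(∂¹ᵀ_μ∂¹_μ ψ)(x) = 2ψ(x) − ψ(x + e_μ) − ψ(x − e_μ)` — valid on every
torus `(ℤ/N)^d`, `N ≥ 1` (for `N ≤ 2` the two neighbours coincide and are counted twice, as they must).
[cite: Balaban1982Higgs1, (1.11) p.605] -/
theorem actC_dd (μ : Fin P.d) (ψ : Site P i → ℂ) (x : Site P i) :
    actC ((B1RG242Torus.deriv P i 1 μ)ᵀ * B1RG242Torus.deriv P i 1 μ) ψ x
      = 2 * ψ x - ψ (Site.shift x μ) - ψ (Site.unshift x μ) := by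
  rw [actC_transpose_mul]
  simp only [actC_deriv, deriv_one_apply, Complex.ofReal_sub, ofReal_ite]
  simp_rw [eq_shift_iff x _ μ]
  simp only [sub_mul, ite_mul, one_mul, zero_mul, Finset.sum_sub_distrib, Finset.sum_ite_eq', Finset.mem_univ,
    if_true, shift_unshift]
  ring

/-- The block projection `Q^*Q` (extension ∘ `w`-weighted block sum) on complex vectors:
`(Q^*Q ψ)(x) = w · Σ_{x′ ∈ B(x)} ψ(x′)`. [cite: Balaban1982Higgs1, (2.20) p.610] -/
theorem actC_EA {i' a : ℕ} (w : ℝ) (ψ : Site P i → ℂ) (x : Site P i) :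
    actC (extMat P i i' a * avgMat P i i' a w) ψ x
      = (w : ℂ) * ∑ x' ∈ Finset.univ.filter (fun x' : Site P i => Site.proj i' a x' = Site.proj i' a x), ψ x' := by
  simp only [actC, EA_apply]
  rw [Finset.sum_filter, Finset.mul_sum]
  refine Finset.sum_congr rfl fun x' _ => ?_
  split_ifs <;> simp

variable (P)

/-- `w_j = (L^j)^{−d}` for `j ≤ m + K`. [folklore] -/
theorem wj_eq_inv {j : ℕ} (hj : j ≤ P.m + P.K) : wj P j = (((P.L : ℝ) ^ j) ^ P.d)⁻¹ := by
  rw [wj, lvl_of_le P hj, inv_pow, ← pow_mul, ← pow_mul, mul_comm]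

/-- `ε/(L^jε) = 1/L^j`. [folklore] -/
theorem eps_div_spacing (j : ℕ) : P.eps / P.spacing j = 1 / (P.L : ℝ) ^ j := by
  have hε : P.eps ≠ 0 := P.eps_pos.ne'
  unfold Params.spacing
  field_simp

/-- The rescaled mass–Laplacian is `L^{2j}` times the unit one: `−Δ^{L^{−j}} + (L^jε)²m² = L^{2j}(−Δ¹ + ε²m²)`.
[cite: Balaban1982Higgs1, (2.22) p.610] -/
theorem hOp_spacing_eq (msq : ℝ) (j : ℕ) :
    hOp P 0 (P.eps / P.spacing j) (P.spacing j ^ 2 * msq) = ((P.L : ℝ) ^ j) ^ 2 • hOp P 0 1 (P.eps ^ 2 * msq) := by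
  have e2 : P.spacing j ^ 2 * msq = ((P.L : ℝ) ^ j) ^ 2 * (P.eps ^ 2 * msq) := by unfold Params.spacing; ring
  rw [eps_div_spacing, e2]
  exact hOp_rescale (P := P) (i := 0) 1 ((P.L : ℝ) ^ j) (P.eps ^ 2 * msq)

variable {P}

/-- **THE LIFT LEMMA.** For `j ≤ m + K` and an `N₀ = |T^{(0)}|`-periodic `φ : ℤ^d → ℂ`, the matrix
`Marg_j = −Δ^{L^{−j}} + m²(L^jε)² + a_jQ_j^*Q_j` of the concrete torus tower (`B4Ineq115Torus.Marg`, the argument of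
`G_j^{resc}` of B1 (2.22)) acts on the restriction `φ ∘ rep` exactly as the fine-lattice stencil `B4Green244.opD` of B4 (2.44)
with `n = L^j`, `a = a_j`, `m² ↦ (L^jε)²m²` (ξ-units, `ξ = L^{−j}`): `(Marg_j (φ∘rep))(x) = (D φ)(rep x)`.
[cite: Balaban1983RegularityDecay, (2.44) p.584; dictionary] [folklore] -/
theorem Marg_lift (a msq : ℝ) {j : ℕ} (hj : j ≤ P.m + P.K) (φ : (Fin P.d → ℤ) → ℂ)
    (hφ : Periodic (P := P) (P.sitesPerDir 0) φ) (x : Site P 0) :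
    actC (Marg P a msq j) (fun x' => φ (rep P x')) x
      = opD (P.L ^ j) (B1.aSeq a P.L j) (P.spacing j ^ 2 * msq) φ (rep P x) := by
  have h0 : P.sitesPerDir 0 = P.L ^ j * P.sitesPerDir j := by
    rw [sitesPerDir_zero_eq P j, lvl_of_le P hj]
  rw [Marg, hOp_spacing_eq, QksQk_eq', lvl_of_le P hj, hOp, actC_add, actC_smul, actC_smul, actC_add, actC_smul,
    actC_one, actC_sum, actC_EA, sum_fibre h0]
  simp only [actC_dd, hφ.shift, hφ.unshift, rep_fibreSite h0, rep_proj h0]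
  have hw : (((P.L : ℝ) ^ P.d)⁻¹) ^ j = (((P.L : ℝ) ^ j) ^ P.d)⁻¹ := by
    rw [inv_pow, ← pow_mul, ← pow_mul, mul_comm]
  rw [hw]
  simp only [opD, negLap, blockAvg, Params.spacing]
  push_cast
  ring

end Lift

/-! ## §3 Uniqueness and identification: the block column `G_j^{resc}Q_j^*` of the tower IS `B4TorusGreen244.KT` -/

section Column

/-- `L^j ≠ 0`. [folklore] -/
instance instNeZeroLpow (P : Params) (j : ℕ) : NeZero (P.L ^ j) := ⟨pow_ne_zero _ P.L_pos.ne'⟩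

variable {P : Params}

/-- THE BLOCK CONDITION AS A CONGRUENCE: `⌊rep x/L^j⌋ ≡ rep y (mod N_j)` coordinatewise iff `x ∈ B^j(y)` (both sides are
reduced representatives in `[0, N_j)`). [folklore] -/
theorem proj_eq_iff_dvd {j : ℕ} (hj : j ≤ P.m + P.K) (x : Site P 0) (y : Site P j) :
    (∀ μ, (P.sitesPerDir j : ℤ) ∣ coarse (P.L ^ j) (rep P x) μ - rep P y μ) ↔ Site.proj j j x = y := by
  have h0 : P.sitesPerDir 0 = P.L ^ j * P.sitesPerDir j := by rw [sitesPerDir_zero_eq P j, lvl_of_le P hj]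
  rw [← rep_proj h0]
  constructor
  · intro h
    apply rep_injective
    funext μ
    have hlt1 := rep_lt (Site.proj j j x) μ
    have hlt2 := rep_lt y μ
    have h1 := rep_nonneg (Site.proj j j x) μ
    have h2 := rep_nonneg y μ
    have habs : |rep P (Site.proj j j x) μ - rep P y μ| < (P.sitesPerDir j : ℤ) := by
      rw [abs_sub_lt_iff]; constructor <;> linarith
    have h3 := Int.eq_zero_of_abs_lt_dvd (h μ) habs
    linarith
  · rintro rfl μ
    simp

/-- THE REAL COLUMN EQUATION: `Marg_j (G_j^{resc}Q_j^* δ_y) = Q_j^*δ_y = 1_{B^j(y)}` (`Marg_j G_j^{resc} = 1`).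
[cite: Balaban1982Higgs1, (2.22) p.610] -/
theorem Marg_mulVec_GQcol {a msq : ℝ} (ha : 0 < a) (hm : 0 ≤ msq) {j : ℕ} (hj1 : 1 ≤ j) (hj : j ≤ P.m + P.K)
    (x : Site P 0) (y : Site P j) :
    (Marg P a msq j *ᵥ fun x' => (Grs P a msq j * Qks P j) x' y) x = if Site.proj j j x = y then 1 else 0 := by
  have h : (Marg P a msq j *ᵥ fun x' => (Grs P a msq j * Qks P j) x' y) x
      = (Marg P a msq j * (Grs P a msq j * Qks P j)) x y := by
    simp only [Matrix.mulVec, dotProduct, Matrix.mul_apply]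
  rw [h, ← Matrix.mul_assoc, Marg_mul_Grs ha hm hj1, Matrix.one_mul]
  simp only [Qks, extMat, lvl_of_le P hj]

/-- **UNIQUENESS ON THE FINITE TORUS**: the complexified torus operator `Marg_j` is injective on `T^{(0)} → ℂ`
(`B4Ineq115Torus.Marg_isUnit`: the finite-volume positivity (2.27), `⟨φ, Marg_j φ⟩ ≥ min{8,a_j}L^{−2j}… > 0`) — the
uniqueness half left open in `B4TorusGreen244` (HONEST SCOPE (ii)). [cite: Balaban1983RegularityDecay, (2.27) p.581 with
(2.44) p.584; dictionary] [folklore] -/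
theorem actC_Marg_injective {a msq : ℝ} (ha : 0 < a) (hm : 0 ≤ msq) {j : ℕ} (hj1 : 1 ≤ j) :
    Function.Injective (fun ψ : Site P 0 → ℂ => fun x => actC (Marg P a msq j) ψ x) := by
  have hU : IsUnit ((Marg P a msq j).map Complex.ofRealHom) :=
    (Marg_isUnit (P := P) ha hm hj1).map Complex.ofRealHom.mapMatrix
  have hinj := Matrix.mulVec_injective_iff_isUnit.mpr hU
  intro ψ ψ' h
  exact hinj (funext fun x => by simpa only [actC_eq_mulVec] using congrFun h x)

/-- `Params` with the dimension in successor form `d = d′ + 1` (the torus engine `B4TorusKernel.MultiPeriod` and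
`B4TorusGreen244` are indexed by `Fin (d′+1)`; every `Params` has this form, `cases_mkP`). [folklore] -/
abbrev mkP (d' L m K : ℕ) (hL : Odd L ∧ 1 < L) : Params := ⟨d' + 1, L, m, K, by omega, hL⟩

variable (d' Lb mb Kb : ℕ) (hL : Odd Lb ∧ 1 < Lb) [NeZero Lb]

local notation "Pm" => mkP d' Lb mb Kb hL

/-- THE TORUS KERNEL COLUMN of B4 (2.48)/`B4TorusGreen244.KT` for the tower at level `j` and block label `y ∈ T^{(j)}`:
`z ↦ K_T(z, rep y)` with `n = L^j`, `a = a_j`, `m² ↦ (L^jε)²m²`, period vector `N_μ = |T^{(j)}|` per direction.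
[cite: Balaban1983RegularityDecay, (2.48) p.585; dictionary] -/
def colKT (a msq : ℝ) (j : ℕ) (y : Site Pm j) : (Fin (d' + 1) → ℤ) → ℂ :=
  fun z => B4TorusGreen244.KT ((Pm).L ^ j) (B1.aSeq a Lb j) ((Pm).spacing j ^ 2 * msq) (Nv Pm j) z (rep Pm y)

/-- The kernel column is `|T^{(0)}|`-periodic in the fine variable (`B4TorusGreen244.KT_translate_left`). [folklore] -/
theorem colKT_periodic (a msq : ℝ) {j : ℕ} (hj : j ≤ mb + Kb) (y : Site Pm j) :
    Periodic (P := Pm) ((Pm).sitesPerDir 0) (colKT d' Lb mb Kb hL a msq j y) := by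
  have h0 : (Pm).sitesPerDir 0 = (Pm).L ^ j * (Pm).sitesPerDir j := by
    rw [sitesPerDir_zero_eq Pm j, lvl_of_le Pm hj]
  intro z k
  have e : (fun μ => z μ + ((Pm).sitesPerDir 0 : ℤ) * k μ)
      = B4TorusKernel.MultiPeriod.translate (fun i => (Pm).L ^ j * Nv Pm j i) z k := by
    funext μ
    simp only [B4TorusKernel.MultiPeriod.translate_apply, Nv, h0]
  unfold colKT
  rw [e]
  exact B4TorusGreen244.KT_translate_left ((Pm).L ^ j) _ _ (Nv_pos Pm j) z _ k

/-- THE COMPLEX COLUMN EQUATION: by the lift lemma and `B4TorusGreen244.torusGreen244`,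
`Marg_j (K_T(rep ·, rep y)) = 1_{B^j(y)}` on `T^{(0)}`. [cite: Balaban1983RegularityDecay, (2.44) p.584; dictionary] -/
theorem actC_Marg_colKT {a msq : ℝ} (ha : 0 < a) (hm : 0 ≤ msq) {j : ℕ} (hj1 : 1 ≤ j) (hj : j ≤ mb + Kb)
    (x : Site Pm 0) (y : Site Pm j) :
    actC (Marg Pm a msq j) (fun x' => colKT d' Lb mb Kb hL a msq j y (rep Pm x')) x
      = if Site.proj j j x = y then 1 else 0 := by
  rw [Marg_lift a msq hj _ (colKT_periodic d' Lb mb Kb hL a msq hj y) x]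
  have hn : 1 ≤ (Pm).L ^ j := Nat.one_le_pow _ _ (Pm).L_pos
  have haj : 0 < B1.aSeq a (Lb : ℝ) j := B1.aSeq_pos ha (one_lt_cast_L Pm) hj1
  have hm2 : 0 ≤ (Pm).spacing j ^ 2 * msq := mul_nonneg (sq_nonneg _) hm
  unfold colKT
  rw [B4TorusGreen244.torusGreen244 ((Pm).L ^ j) hn _ _ haj hm2 (Nv_pos Pm j) (rep Pm x) (rep Pm y)]
  exact if_congr (proj_eq_iff_dvd hj x y) rfl rfl

/-- **IDENTIFICATION (B4Torus248Decay NOT-covered (ii), B4TorusGreen244 HONEST SCOPE (ii), for the concrete tower)**: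
for `a > 0`, `m² ≥ 0`, `1 ≤ j ≤ m + K` and all `x ∈ T^{(0)}`, `y ∈ T^{(j)}`,
`(G_j^{resc} Q_j^*)(x, y) = K_T(rep x, rep y) = torusKernel248 (L^j) a_j (L^jε)²m² (rep x mod L^j) N (⌊rep x/L^j⌋ − rep y)`:
the block column of the rescaled propagator (2.22) of the torus tower IS the finite dual-grid kernel of B4 (2.48).
[cite: Balaban1983RegularityDecay, (2.47)–(2.48) p.585 with p.572 (torus); dictionary] [folklore] -/
theorem GQ_eq_KT {a msq : ℝ} (ha : 0 < a) (hm : 0 ≤ msq) {j : ℕ} (hj1 : 1 ≤ j) (hj : j ≤ mb + Kb)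
    (x : Site Pm 0) (y : Site Pm j) :
    (((Grs Pm a msq j * Qks Pm j) x y : ℝ) : ℂ) = colKT d' Lb mb Kb hL a msq j y (rep Pm x) := by
  have key : (fun x' => (((Grs Pm a msq j * Qks Pm j) x' y : ℝ) : ℂ))
      = fun x' => colKT d' Lb mb Kb hL a msq j y (rep Pm x') := by
    apply actC_Marg_injective (P := Pm) ha hm hj1
    funext x'
    show actC _ _ x' = actC _ _ x'
    rw [actC_ofReal, Marg_mulVec_GQcol ha hm hj1 hj, actC_Marg_colKT d' Lb mb Kb hL ha hm hj1 hj, ofReal_ite]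
  exact congrFun key x

/-- … hence the entries of `G_j^{resc}Q_j^*` are the values of the torus kernel: `(G_j^{resc}Q_j^*)(x,y) =
Re K_T(rep x, rep y)` and `K_T(rep x, rep y)` is real. [folklore] -/
theorem GQ_eq_re_KT {a msq : ℝ} (ha : 0 < a) (hm : 0 ≤ msq) {j : ℕ} (hj1 : 1 ≤ j) (hj : j ≤ mb + Kb)
    (x : Site Pm 0) (y : Site Pm j) :
    (Grs Pm a msq j * Qks Pm j) x y = (colKT d' Lb mb Kb hL a msq j y (rep Pm x)).re := by
  rw [← GQ_eq_KT d' Lb mb Kb hL ha hm hj1 hj x y, Complex.ofReal_re]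

end Column

/-! ## §4 (2.35) on the torus, first quantity: uniform decay of `G_j^{resc}Q_j^*` and `Q_jG_j^{resc}Q_j^*` -/

section Decay

variable (d' Lb mb Kb : ℕ) (hL : Odd Lb ∧ 1 < Lb) [NeZero Lb]

local notation "Pm" => mkP d' Lb mb Kb hL

omit [NeZero Lb] in
/-- THE METRIC DICTIONARY: the tower's sup torus distance `T^{(j)}` (`B5Ineq137Torus.T`, ξ-units) is dominated by
(indeed equal to) the torus sup norm of `B4TorusKernel.MultiPeriod` on the difference of representatives. [folklore] -/
theorem T_le_torusSupNorm {j : ℕ} (y' y : Site Pm j) :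
    T Pm j y' y ≤ B4TorusKernel.MultiPeriod.torusSupNorm (Nv Pm j) (rep Pm y' - rep Pm y) := by
  obtain ⟨i₀, -, hi₀⟩ := Finset.exists_mem_eq_sup (Finset.univ : Finset (Fin (d' + 1))) Finset.univ_nonempty
    (B4Sect5Torus.ccoord (Nv Pm j) (toT y') (toT y))
  have hc := B4Sect5Torus.ccoord_cast (Nv_pos Pm j) (toT y') (toT y) i₀
  have e1 : T Pm j y' y = ((B4Sect5Torus.ccoord (Nv Pm j) (toT y') (toT y) i₀ : ℕ) : ℝ) := by
    simp only [T, B4Sect5Torus.tdist, hi₀]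
  have e2 : ((B4Sect5Torus.ccoord (Nv Pm j) (toT y') (toT y) i₀ : ℕ) : ℝ)
      = ((B4TorusKernel.MultiPeriod.circAbs (Nv Pm j i₀) ((rep Pm y' - rep Pm y) i₀) : ℤ) : ℝ) := by
    rw [← Int.cast_natCast, hc]
    rfl
  rw [e1, e2]
  exact Finset.le_sup' (fun i => ((B4TorusKernel.MultiPeriod.circAbs (Nv Pm j i) ((rep Pm y' - rep Pm y) i) : ℤ) : ℝ))
    (Finset.mem_univ i₀)

/-- `0 ≤ periodConst κ d`. [folklore] -/
theorem periodConst_nonneg {κ : ℝ} (hκ : 0 ≤ κ) (d : ℕ) : 0 ≤ B4TorusKernel.periodConst κ d := by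
  unfold B4TorusKernel.periodConst
  apply pow_nonneg
  apply div_nonneg (by positivity)
  have : Real.exp (-(κ / (d + 1))) ≤ 1 := Real.exp_le_one_iff.mpr (by
    have : 0 ≤ κ / (d + 1) := by positivity
    linarith)
  linarith

/-- `a(1 − L^{−2}) > 0`. [folklore] -/
theorem ainf_pos {a L : ℝ} (ha : 0 < a) (hL : 1 < L) : 0 < a * (1 - (L ^ 2)⁻¹) := by
  have hL2 : 1 < L ^ 2 := by nlinarith
  have : (L ^ 2)⁻¹ < 1 := inv_lt_one_of_one_lt₀ hL2
  exact mul_pos ha (by linarith)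

/-- The decay hypothesis package of `B4Torus248Decay.kernel248_torusKernel_decay_torusMetric` at the constants of the
tower: `a₋ = a(1 − L^{−2})`, `a₊ = a`, mass cap `m²₊`. [folklore] -/
def DecayHyp (a m2plus κ M : ℝ) : Prop :=
  ∀ (n : ℕ) [NeZero n] (a' m2 : ℝ), a * (1 - ((Lb : ℝ) ^ 2)⁻¹) ≤ a' → a' ≤ a → 0 ≤ m2 → m2 ≤ m2plus →
    ∀ (τ : Fin (d' + 1) → Fin n) (N : Fin (d' + 1) → ℕ), (∀ i, 1 ≤ N i) → ∀ x : Fin (d' + 1) → ℤ,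
      ‖B4Torus248Decay.torusKernel248 n a' m2 τ N x‖
        ≤ M * B4TorusKernel.periodConst κ d' * Real.exp (-(κ / (d' + 1) * B4TorusKernel.MultiPeriod.torusSupNorm N x))

omit [NeZero Lb] in
/-- The package holds with constants depending on `d′, L, a, m²₊` only (b04's theorem). [cite: Balaban1983RegularityDecay,
(2.48) p.585 with Balaban1984PropagatorsI (1.126) p.38; dictionary] [folklore] -/
theorem decayHyp_exists {a : ℝ} (ha : 0 < a) (hL1 : (1 : ℝ) < Lb) (m2plus : ℝ) :
    ∃ κ M : ℝ, 0 < κ ∧ 0 ≤ M ∧ DecayHyp d' Lb a m2plus κ M :=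
  B4Torus248Decay.kernel248_torusKernel_decay_torusMetric d' (a * (1 - ((Lb : ℝ) ^ 2)⁻¹)) a m2plus (ainf_pos ha hL1)

/-- (2.35) on the torus, first quantity, AT ONE VOLUME AND LEVEL, from the decay package: `|(G_j^{resc}Q_j^*)(x,y)| ≤
M·C(κ,d′)·e^{−κ/(d′+1)·T^{(j)}(proj x, y)}` and `|(Q_jG_j^{resc}Q_j^*)(y′,y)| ≤ M·C(κ,d′)·e^{−κ/(d′+1)·T^{(j)}(y′,y)}`.
[cite: Balaban1983RegularityDecay, Prop. 2.4 (2.35) p.582 with p.572 (torus); dictionary] [folklore] -/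
theorem GQ_bound_of {a m2plus κ M : ℝ} (ha : 0 < a) (hκ : 0 < κ) (hM : 0 ≤ M) (hdec : DecayHyp d' Lb a m2plus κ M)
    {msq : ℝ} (hmsq : 0 ≤ msq) {j : ℕ} (hj1 : 1 ≤ j) (hj : j ≤ mb + Kb) (hcap : (Pm).spacing j ^ 2 * msq ≤ m2plus) :
    (∀ (x : Site Pm 0) (y : Site Pm j), |(Grs Pm a msq j * Qks Pm j) x y|
        ≤ M * B4TorusKernel.periodConst κ d' * Real.exp (-(κ / (d' + 1) * T Pm j (Site.proj j j x) y))) ∧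
    (∀ (y' y : Site Pm j), |(Qk Pm j * Grs Pm a msq j * Qks Pm j) y' y|
        ≤ M * B4TorusKernel.periodConst κ d' * Real.exp (-(κ / (d' + 1) * T Pm j y' y))) := by
  have hL1 : (1 : ℝ) < Lb := by exact_mod_cast hL.2
  have h0 : (Pm).sitesPerDir 0 = (Pm).L ^ j * (Pm).sitesPerDir j := by
    rw [sitesPerDir_zero_eq Pm j, lvl_of_le Pm hj]
  have hC : 0 ≤ M * B4TorusKernel.periodConst κ d' := mul_nonneg hM (periodConst_nonneg hκ.le d')
  have hGQ : ∀ (x : Site Pm 0) (y : Site Pm j), |(Grs Pm a msq j * Qks Pm j) x y|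
      ≤ M * B4TorusKernel.periodConst κ d' * Real.exp (-(κ / (d' + 1) * T Pm j (Site.proj j j x) y)) := by
    intro x y
    have e := GQ_eq_KT d' Lb mb Kb hL ha hmsq hj1 hj x y
    have hn : |(Grs Pm a msq j * Qks Pm j) x y| = ‖colKT d' Lb mb Kb hL a msq j y (rep Pm x)‖ := by
      rw [← e, Complex.norm_real, Real.norm_eq_abs]
    rw [hn]
    have hb := hdec ((Pm).L ^ j) (B1.aSeq a (Lb : ℝ) j) ((Pm).spacing j ^ 2 * msq)
      (B1.ainf_lt_aSeq ha hL1 j hj1).le (B1.aSeq_le ha hL1 j hj1) (mul_nonneg (sq_nonneg _) hmsq) hcap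
      (offset ((Pm).L ^ j) (rep Pm x)) (Nv Pm j) (Nv_pos Pm j) (coarse ((Pm).L ^ j) (rep Pm x) - rep Pm y)
    refine le_trans hb ?_
    refine mul_le_mul_of_nonneg_left (Real.exp_le_exp.mpr ?_) hC
    rw [← rep_proj h0]
    have hT := T_le_torusSupNorm d' Lb mb Kb hL (Site.proj j j x) y
    have hκ' : 0 ≤ κ / (d' + 1) := by positivity
    nlinarith
  refine ⟨hGQ, ?_⟩
  intro y' y
  have hQ : (Qk Pm j * Grs Pm a msq j * Qks Pm j) y' y
      = ∑ x ∈ Finset.univ.filter (fun x : Site Pm 0 => Site.proj j j x = y'),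
          wj Pm j * (Grs Pm a msq j * Qks Pm j) x y := by
    rw [Matrix.mul_assoc, Matrix.mul_apply, Finset.sum_filter]
    refine Finset.sum_congr rfl fun x _ => ?_
    simp only [Qk_eq, avgMat, lvl_of_le Pm hj]
    split_ifs <;> simp
  rw [hQ]
  refine le_trans (Finset.abs_sum_le_sum_abs _ _) ?_
  have hw : 0 < wj Pm j := wj_pos Pm j
  have hterm : ∀ x ∈ Finset.univ.filter (fun x : Site Pm 0 => Site.proj j j x = y'),
      |wj Pm j * (Grs Pm a msq j * Qks Pm j) x y|
        ≤ wj Pm j * (M * B4TorusKernel.periodConst κ d' * Real.exp (-(κ / (d' + 1) * T Pm j y' y))) := by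
    intro x hx
    rw [Finset.mem_filter] at hx
    rw [abs_mul, abs_of_pos hw]
    refine mul_le_mul_of_nonneg_left ?_ hw.le
    have := hGQ x y
    rwa [hx.2] at this
  refine le_trans (Finset.sum_le_sum hterm) ?_
  rw [Finset.sum_const, card_Bj (P := Pm) hj y', nsmul_eq_mul, wj_eq_inv Pm hj]
  have hLj : (((Pm).L : ℝ) ^ j) ^ (Pm).d ≠ 0 := pow_ne_zero _ (pow_ne_zero _ (Pm).cast_L_pos.ne')
  push_cast
  rw [← mul_assoc, mul_inv_cancel₀ hLj, one_mul]

end Decay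

/-! ## §5 `Hyp56` for the argument of `C^{(j)}` and (1.16) on the torus at one volume and level -/

section Cov116

variable {P : Params}

/-- `stepExp j ≤ 1`. [folklore] -/
theorem stepExp_le_one (j : ℕ) : stepExp P j ≤ 1 := by unfold stepExp lvl; omega

/-- THE ONE-STEP BLOCK PROJECTION HAS RANGE `L − 1`: `|(Q^*Q)(y′,y)| ≤ e^{κ(L−1)} e^{−κT^{(j)}(y′,y)}` for every `κ ≥ 0`
(entries `L^{−d·stepExp} ≤ 1`, vanishing unless `y, y′` lie in a common `L^{stepExp}`-block). [cite: Balaban1982Higgs1, (2.7) p.608] -/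
theorem abs_QsQ_le {κ : ℝ} (hκ : 0 ≤ κ) (j : ℕ) (y' y : Site P j) :
    |(Qs P j * Q P j) y' y| ≤ Real.exp (κ * ((P.L : ℝ) - 1)) * Real.exp (-(κ * T P j y' y)) := by
  rw [QsQ_eq]
  by_cases h : (extMat P j (j + 1) (stepExp P j) * avgMat P j (j + 1) (stepExp P j)
      ((((P.L : ℝ) ^ P.d)⁻¹) ^ stepExp P j)) y' y = 0
  · rw [h, abs_zero]; positivity
  · have hT := T_le_of_EA_ne_zero (P := P) (sitesPerDir_eq_succ P j) _ h
    have h1 : (1 : ℝ) ≤ P.L := (one_lt_cast_L P).le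
    have hstep : (P.L : ℝ) ^ stepExp P j ≤ (P.L : ℝ) := by
      have := pow_le_pow_right₀ h1 (stepExp_le_one (P := P) j)
      rwa [pow_one] at this
    have hw0 : 0 < (((P.L : ℝ) ^ P.d)⁻¹) ^ stepExp P j := pow_pos (inv_pos.mpr (pow_pos P.cast_L_pos _)) _
    have hw1 : (((P.L : ℝ) ^ P.d)⁻¹) ^ stepExp P j ≤ 1 :=
      pow_le_one₀ (inv_pos.mpr (pow_pos P.cast_L_pos _)).le (inv_le_one_of_one_le₀ (one_le_pow₀ h1))
    have habs : |(extMat P j (j + 1) (stepExp P j) * avgMat P j (j + 1) (stepExp P j)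
        ((((P.L : ℝ) ^ P.d)⁻¹) ^ stepExp P j)) y' y| ≤ 1 := by
      rw [EA_apply]
      split_ifs
      · rw [abs_of_pos hw0]; exact hw1
      · simp
    refine le_trans habs ?_
    rw [← Real.exp_add]
    exact Real.one_le_exp (by nlinarith)

/-- THE IDENTITY HAS RANGE `0`: `|δ_{y′y}| ≤ e^{−κT^{(j)}(y′,y)}`. [folklore] -/
theorem abs_one_apply_le (κ : ℝ) (j : ℕ) (y' y : Site P j) :
    |(1 : Matrix (Site P j) (Site P j) ℝ) y' y| ≤ Real.exp (-(κ * T P j y' y)) := by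
  rw [Matrix.one_apply]
  split_ifs with h
  · subst h; rw [T_self, mul_zero, neg_zero, Real.exp_zero, abs_one]
  · rw [abs_zero]; positivity

variable (d' Lb mb Kb : ℕ) (hL : Odd Lb ∧ 1 < Lb) [NeZero Lb]

local notation "Pm" => mkP d' Lb mb Kb hL

/-- THE (5.6) ENTRY CONSTANT of the argument of `C^{(j)}`: `c₀ = aL^{−2}e^{κ′(L−1)} + a + a²·M·C(κ,d′)`, `κ′ = κ/(d′+1)` —
a function of `d′, L, a` and b04's `(κ, M)` only. [cite: Balaban1983RegularityDecay, (5.6) p.594] -/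
def c116 (a κ M : ℝ) : ℝ :=
  a * ((Lb : ℝ) ^ 2)⁻¹ * Real.exp (κ / (d' + 1) * ((Lb : ℝ) - 1)) + a
    + a ^ 2 * (M * B4TorusKernel.periodConst κ d')

omit [NeZero Lb] in
/-- `0 ≤ c₀`. [folklore] -/
theorem c116_nonneg {a κ M : ℝ} (ha : 0 < a) (hκ : 0 < κ) (hM : 0 ≤ M) : 0 ≤ c116 d' Lb a κ M := by
  have := periodConst_nonneg hκ.le d'
  unfold c116
  positivity

/-- **THE ENTRY DECAY (clause 3 of `Hyp56`) of the argument `aL^{−2}Q^*Q + Δ^{(j),resc}` of `C^{(j)}`** at one volume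
and level: `|Carg(y′,y)| ≤ c₀ e^{−κ′T^{(j)}(y′,y)}`. [cite: Balaban1983RegularityDecay, (5.6) p.594 with Prop. 2.4
(2.35) p.582; dictionary] [folklore] -/
theorem abs_Carg_le {a m2plus κ M : ℝ} (ha : 0 < a) (hκ : 0 < κ) (hM : 0 ≤ M) (hdec : DecayHyp d' Lb a m2plus κ M)
    {msq : ℝ} (hmsq : 0 ≤ msq) {j : ℕ} (hj1 : 1 ≤ j) (hj : j ≤ mb + Kb) (hcap : (Pm).spacing j ^ 2 * msq ≤ m2plus)
    (y' y : Site Pm j) :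
    |Carg Pm a msq j y' y| ≤ c116 d' Lb a κ M * Real.exp (-(κ / (d' + 1) * T Pm j y' y)) := by
  have hL1 : (1 : ℝ) < Lb := by exact_mod_cast hL.2
  have hκ' : 0 ≤ κ / (d' + 1) := by positivity
  have haj0 : 0 < B1.aSeq a (Lb : ℝ) j := B1.aSeq_pos ha hL1 hj1
  have haj : B1.aSeq a (Lb : ℝ) j ≤ a := B1.aSeq_le ha hL1 j hj1
  have hQGQ := (GQ_bound_of d' Lb mb Kb hL ha hκ hM hdec hmsq hj1 hj hcap).2 y' y
  have hQsQ := abs_QsQ_le (P := Pm) hκ' j y' y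
  have hone := abs_one_apply_le (P := Pm) (κ / (d' + 1)) j y' y
  set E := Real.exp (-(κ / (d' + 1) * T Pm j y' y)) with hE
  have hE0 : 0 < E := Real.exp_pos _
  have hC : 0 ≤ M * B4TorusKernel.periodConst κ d' := mul_nonneg hM (periodConst_nonneg hκ.le d')
  have e : Carg Pm a msq j y' y = a * (((Pm).L : ℝ) ^ 2)⁻¹ * (Qs Pm j * Q Pm j) y' y
      + (B1.aSeq a (Lb : ℝ) j * (1 : Matrix (Site Pm j) (Site Pm j) ℝ) y' y
        - B1.aSeq a (Lb : ℝ) j ^ 2 * (Qk Pm j * Grs Pm a msq j * Qks Pm j) y' y) := by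
    simp only [Carg, Drs, Matrix.add_apply, Matrix.sub_apply, Matrix.smul_apply, smul_eq_mul]
  rw [e]
  have hPL : ((Pm).L : ℝ) = (Lb : ℝ) := rfl
  have h1 : |a * (((Pm).L : ℝ) ^ 2)⁻¹ * (Qs Pm j * Q Pm j) y' y|
      ≤ a * ((Lb : ℝ) ^ 2)⁻¹ * Real.exp (κ / (d' + 1) * ((Lb : ℝ) - 1)) * E := by
    have hpos : (0 : ℝ) < a * ((Lb : ℝ) ^ 2)⁻¹ := by positivity
    rw [hPL, abs_mul, abs_of_pos hpos, mul_assoc (a * ((Lb : ℝ) ^ 2)⁻¹)]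
    rw [hPL] at hQsQ
    exact mul_le_mul_of_nonneg_left hQsQ hpos.le
  have h2 : |B1.aSeq a (Lb : ℝ) j * (1 : Matrix (Site Pm j) (Site Pm j) ℝ) y' y| ≤ a * E := by
    rw [abs_mul, abs_of_pos haj0]
    exact mul_le_mul haj hone (abs_nonneg _) ha.le
  have h3 : |B1.aSeq a (Lb : ℝ) j ^ 2 * (Qk Pm j * Grs Pm a msq j * Qks Pm j) y' y|
      ≤ a ^ 2 * (M * B4TorusKernel.periodConst κ d') * E := by
    rw [abs_mul, abs_of_pos (pow_pos haj0 2), mul_assoc]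
    exact mul_le_mul (pow_le_pow_left₀ haj0.le haj 2) hQGQ (abs_nonneg _) (sq_nonneg _)
  calc |a * (((Pm).L : ℝ) ^ 2)⁻¹ * (Qs Pm j * Q Pm j) y' y
        + (B1.aSeq a (Lb : ℝ) j * (1 : Matrix (Site Pm j) (Site Pm j) ℝ) y' y
          - B1.aSeq a (Lb : ℝ) j ^ 2 * (Qk Pm j * Grs Pm a msq j * Qks Pm j) y' y)|
      ≤ |a * (((Pm).L : ℝ) ^ 2)⁻¹ * (Qs Pm j * Q Pm j) y' y|
        + (|B1.aSeq a (Lb : ℝ) j * (1 : Matrix (Site Pm j) (Site Pm j) ℝ) y' y|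
          + |B1.aSeq a (Lb : ℝ) j ^ 2 * (Qk Pm j * Grs Pm a msq j * Qks Pm j) y' y|) :=
        le_trans (abs_add_le _ _) (add_le_add_right (abs_sub _ _) _)
    _ ≤ a * ((Lb : ℝ) ^ 2)⁻¹ * Real.exp (κ / (d' + 1) * ((Lb : ℝ) - 1)) * E + (a * E
          + a ^ 2 * (M * B4TorusKernel.periodConst κ d') * E) := add_le_add h1 (add_le_add h2 h3)
    _ = c116 d' Lb a κ M * E := by unfold c116; ring

/-- **`Hyp56` FOR THE ARGUMENT OF `C^{(j)}` ON THE TORUS** (symmetry `B4Ineq115Torus.Carg_isSymm`, coercivity (1.15) =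
`B4Ineq115Torus.Carg_coercive_sum` with `γ₀ = gamma115u L a`, entry decay `abs_Carg_le`).
[cite: Balaban1983RegularityDecay, (5.6) p.594 with (1.15) p.574; dictionary] [folklore] -/
theorem Carg_hyp56 {a m2plus κ M : ℝ} (ha : 0 < a) (hκ : 0 < κ) (hM : 0 ≤ M) (hdec : DecayHyp d' Lb a m2plus κ M)
    {msq : ℝ} (hmsq : 0 ≤ msq) {j : ℕ} (hj1 : 1 ≤ j) (hj : j ≤ mb + Kb) (hcap : (Pm).spacing j ^ 2 * msq ≤ m2plus) :
    B4Sect5Torus.Hyp56 (T Pm j) (Carg Pm a msq j) (gamma115u (Lb : ℝ) a) (c116 d' Lb a κ M) (κ / (d' + 1)) :=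
  ⟨Carg_isSymm (P := Pm) a msq j, fun v => Carg_coercive_sum (P := Pm) ha hmsq hj1 v,
    fun y' y => abs_Carg_le d' Lb mb Kb hL ha hκ hM hdec hmsq hj1 hj hcap y' y⟩

/-- **(1.16) ON THE TORUS AT ONE VOLUME AND LEVEL**: `|C^{(j)}(y,y′)| ≤ (2/γ₀) e^{−δ₁T^{(j)}(y,y′)}` with
`γ₀ = gamma115u L a` and `δ₁ = B4Sect5Torus.rate (K_{d}) γ₀ c₀ (κ/(d′+1))` — the Theorem of Sect. 5 of [4], (5.7)
p. 594, in the tree by finite Combes–Thomas (`B4Sect5Torus.inv_decay` [folklore]), not by the printed random walk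
(5.16)–(5.21). [cite: Balaban1983RegularityDecay, Prop. 2.3 (1.16) p.574 with Sect. 5 Theorem (5.7) p.594; dictionary]
[folklore] -/
theorem abs_Crs_le {a m2plus κ M : ℝ} (ha : 0 < a) (hκ : 0 < κ) (hM : 0 ≤ M) (hdec : DecayHyp d' Lb a m2plus κ M)
    {msq : ℝ} (hmsq : 0 ≤ msq) {j : ℕ} (hj1 : 1 ≤ j) (hj : j ≤ mb + Kb) (hcap : (Pm).spacing j ^ 2 * msq ≤ m2plus)
    (y y' : Site Pm j) :
    |Crs Pm a msq j y y'| ≤ 2 / gamma115u (Lb : ℝ) a *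
      Real.exp (-(B4Sect5Torus.rate (B4Sect5Proof.latticeConst (d' + 1)) (gamma115u (Lb : ℝ) a) (c116 d' Lb a κ M)
        (κ / (d' + 1)) * T Pm j y y')) := by
  have hL1 : (1 : ℝ) < Lb := by exact_mod_cast hL.2
  rw [Crs_eq]
  exact B4Sect5Torus.inv_decay (fun _ hb => B4Sect5Proof.latticeConst_nonneg (d' + 1) hb.le) (gamma115u_pos ha hL1)
    (c116_nonneg d' Lb ha hκ hM) (by positivity) (T_isPseudoDist Pm j) (T_sumBound Pm j)
    (Carg_hyp56 d' Lb mb Kb hL ha hκ hM hdec hmsq hj1 hj hcap) y y'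

end Cov116

/-! ## §6 (1.16) on the torus for the concrete tower, uniformly in the volume and the level -/

section Uniform

/-- **B4 PROPOSITION 2.3 (1.16) ON THE TORUS FOR THE RESCALED FLUCTUATION COVARIANCE OF THE CONCRETE SCALAR TOWER.**
For every dimension `d ≥ 1`, odd `L > 1`, `a > 0` and mass cap `m²₊` there are `δ₀ > 0` and `c₀ ≥ 0`, depending on
`d, L, a, m²₊` ONLY, such that for EVERY volume (`m, K`), every `m² ≥ 0`, every level `1 ≤ j ≤ m + K` with
`(L^jε)²m² ≤ m²₊` and all `y, y′ ∈ T^{(j)}`: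
`|C^{(j)}(y, y′)| = |((aL^{−2}Q^*Q + Δ^{(j),resc})^{−1})(y, y′)| ≤ c₀ e^{−δ₀ T^{(j)}(y,y′)}`
(`T^{(j)}` = sup torus distance in `L^jε`-units = the printed `ξ^{−1}|y − y′|`). The complementary bounds
`γ₀I ≤ C^{(j)} ≤ γ₁I` of (1.16) are `B4Ineq115Torus.Crs_form_bounds` / `ineq115`. [cite: Balaban1983RegularityDecay,
Prop. 2.3 (1.16) p.574 with p.572 (torus); dictionary] [folklore] -/
theorem cov116_torus (d L : ℕ) (hd : 1 ≤ d) (hL : Odd L ∧ 1 < L) {a : ℝ} (ha : 0 < a) (m2plus : ℝ) :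
    ∃ δ₀ c₀ : ℝ, 0 < δ₀ ∧ 0 ≤ c₀ ∧ ∀ (P : Params), P.d = d → P.L = L → ∀ (msq : ℝ), 0 ≤ msq →
      ∀ j : ℕ, 1 ≤ j → j ≤ P.m + P.K → P.spacing j ^ 2 * msq ≤ m2plus →
        ∀ y y' : Site P j, |Crs P a msq j y y'| ≤ c₀ * Real.exp (-(δ₀ * T P j y y')) := by
  obtain ⟨d', rfl⟩ : ∃ d', d = d' + 1 := ⟨d - 1, by omega⟩
  haveI : NeZero L := ⟨by have := hL.2; omega⟩
  have hL1 : (1 : ℝ) < L := by exact_mod_cast hL.2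
  obtain ⟨κ, M, hκ, hM, hdec⟩ := decayHyp_exists d' L ha hL1 m2plus
  refine ⟨B4Sect5Torus.rate (B4Sect5Proof.latticeConst (d' + 1)) (gamma115u (L : ℝ) a) (c116 d' L a κ M) (κ / (d' + 1)),
    2 / gamma115u (L : ℝ) a,
    B4Sect5Torus.rate_pos (fun _ hb => B4Sect5Proof.latticeConst_nonneg (d' + 1) hb.le) (gamma115u_pos ha hL1)
      (c116_nonneg d' L ha hκ hM) (by positivity),
    (div_pos two_pos (gamma115u_pos ha hL1)).le, ?_⟩
  intro P hPd hPL msq hmsq j hj1 hj hcap y y'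
  obtain ⟨dP, LP, mP, KP, hdP, hLP⟩ := P
  simp only at hPd hPL
  subst hPd hPL
  exact abs_Crs_le d' LP mP KP hLP ha hκ hM hdec hmsq hj1 hj hcap y y'

/-- The same with the first quantity of (2.35): uniform decay of `G_j^{resc}Q_j^*` (block distance of `proj x` and `y`)
and of `Q_jG_j^{resc}Q_j^*` for the concrete tower, constants depending on `d, L, a, m²₊` only.
[cite: Balaban1983RegularityDecay, Prop. 2.4 (2.35) p.582 with p.572 (torus); dictionary] [folklore] -/
theorem GQ_decay_torus (d L : ℕ) (hd : 1 ≤ d) (hL : Odd L ∧ 1 < L) {a : ℝ} (ha : 0 < a) (m2plus : ℝ) :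
    ∃ κ C : ℝ, 0 < κ ∧ 0 ≤ C ∧ ∀ (P : Params), P.d = d → P.L = L → ∀ (msq : ℝ), 0 ≤ msq →
      ∀ j : ℕ, 1 ≤ j → j ≤ P.m + P.K → P.spacing j ^ 2 * msq ≤ m2plus →
        (∀ (x : Site P 0) (y : Site P j),
            |(Grs P a msq j * Qks P j) x y| ≤ C * Real.exp (-(κ * T P j (Site.proj j j x) y))) ∧
        (∀ y' y : Site P j, |(Qk P j * Grs P a msq j * Qks P j) y' y| ≤ C * Real.exp (-(κ * T P j y' y))) := by
  obtain ⟨d', rfl⟩ : ∃ d', d = d' + 1 := ⟨d - 1, by omega⟩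
  haveI : NeZero L := ⟨by have := hL.2; omega⟩
  have hL1 : (1 : ℝ) < L := by exact_mod_cast hL.2
  obtain ⟨κ, M, hκ, hM, hdec⟩ := decayHyp_exists d' L ha hL1 m2plus
  refine ⟨κ / (d' + 1), M * B4TorusKernel.periodConst κ d', by positivity, mul_nonneg hM (periodConst_nonneg hκ.le d'),
    ?_⟩
  intro P hPd hPL msq hmsq j hj1 hj hcap
  obtain ⟨dP, LP, mP, KP, hdP, hLP⟩ := P
  simp only at hPd hPL
  subst hPd hPL
  exact GQ_bound_of d' LP mP KP hLP ha hκ hM hdec hmsq hj1 hj hcap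

end Uniform

/-! ## §7 The `K2` conjunct of the located leaf (`B5Leaf237C0Torus.LeafK123`) for the concrete tower -/

section K2leaf

/-- `L^jε ≤ L^kε` for `j ≤ k`. [folklore] -/
theorem spacing_le_spacing (P : Params) {j k : ℕ} (hjk : j ≤ k) : P.spacing j ≤ P.spacing k := by
  simp only [Params.spacing]
  exact mul_le_mul_of_nonneg_right (pow_le_pow_right₀ (one_lt_cast_L P).le hjk) P.eps_pos.le

/-- **THE `K2` LINE OF (1.136)–(1.137) FOR THE CONCRETE TOWER** — the `K2` conjunct of `B5Leaf237C0Torus.LeafK123` for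
`B5Display136Torus.scaleData P S (B5Ineq137Torus.aux P S cube comp) a msq` (whose fields are `K2 := K2 P a msq`,
`dUU := dUU P`, `U := (i : ℕ) × Site P i` by `rfl`), at all levels `1 ≤ j < k ≤ m + K` under the mass cap at level
`k`: `|K2 j u u′| ≤ c₀e^{−δ₀ dUU j u u′}` with `δ₀, c₀` depending on `d, L, a, m²₊` only (`K2 j ⟨j,y⟩ ⟨j,y′⟩ =
C^{(j)}(y,y′)` by `K2_eq`, zero off level `j`; `dUU j` = `T^{(j)}` on level `j` by `dUU_level`).
[cite: Balaban1984PropagatorsI, (1.136)–(1.137) p.40 with Balaban1983RegularityDecay (1.16) p.574; dictionary] [folklore] -/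
theorem K2_decay_torus (d L : ℕ) (hd : 1 ≤ d) (hL : Odd L ∧ 1 < L) {a : ℝ} (ha : 0 < a) (m2plus : ℝ) :
    ∃ δ₀ c₀ : ℝ, 0 < δ₀ ∧ 0 ≤ c₀ ∧ ∀ (P : Params), P.d = d → P.L = L → ∀ (msq : ℝ), 0 ≤ msq →
      ∀ k : ℕ, k ≤ P.m + P.K → P.spacing k ^ 2 * msq ≤ m2plus →
        ∀ j : ℕ, 1 ≤ j → j < k → ∀ u u' : (i : ℕ) × Site P i,
          |K2 P a msq j u u'| ≤ c₀ * Real.exp (-(δ₀ * dUU P j u u')) := by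
  obtain ⟨δ₀, c₀, hδ, hc, h⟩ := cov116_torus d L hd hL ha m2plus
  refine ⟨δ₀, c₀, hδ, hc, ?_⟩
  intro P hPd hPL msq hmsq k hk hcap j hj1 hjk u u'
  have hj : j ≤ P.m + P.K := hjk.le.trans hk
  have hcapj : P.spacing j ^ 2 * msq ≤ m2plus := by
    refine le_trans ?_ hcap
    exact mul_le_mul_of_nonneg_right
      (pow_le_pow_left₀ (P.spacing_pos j).le (spacing_le_spacing P hjk.le) 2) hmsq
  obtain ⟨i, y⟩ := u
  obtain ⟨i', y'⟩ := u'
  by_cases hi : j = i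
  · subst hi
    by_cases hi' : j = i'
    · subst hi'
      rw [K2_eq (P := P) ha hmsq hj1, dUU_level (P := P) hj]
      exact h P hPd hPL msq hmsq j hj1 hj hcapj y y'
    · have e0 : K2 P a msq j ⟨j, y⟩ ⟨i', y'⟩ = 0 := by
        rw [K2, atLevel_mk, atLevel_of_ne (P := P) _ _ _ (fun h' => hi' h'.symm), mul_zero]
      rw [e0, abs_zero]; positivity
  · have e0 : K2 P a msq j ⟨i, y⟩ ⟨i', y'⟩ = 0 := by
      rw [K2, atLevel_of_ne (P := P) _ _ ⟨i, y⟩ (fun h' => hi h'.symm), mul_zero]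
    rw [e0, abs_zero]; positivity

end K2leaf

end

end B4Ineq116Torus

end Literature.MathematicalPhysics.QuantumFieldTheory.Balaban1983to89
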